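import Mathlib
import Summits.ValiantsHypothesis.ValiantsHypothesis.Theorems.LacunarySymmetroidMatrixDescartesCensusWindowFourInterlacing

/-!
# `MatrixDescartes` census — WINDOW-4 WITNESS ROWS: rational certificates that an alternating 4-nomial has at most two positive roots

HONEST FRAMING.  Object-search cell `pub-symmetroid`, door-A target `DoorA26 := PosRootLawAt 2 6 19`
(stmt-ValiantsHypothesis-19979; OPEN, typed, never asserted).  Companion of `…CensusWindowFourInterlacing`
(`fourNomial_interlacing_of_three_posRoots`: if `g = a − b X^u + c X^(u+v) − e X^(u+v+w)`, `a, b > 0`, has three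
positive roots then the two positive roots `s₁ < s₂` of `T₂ = u·b − (u+v)·c X^v + (u+v+w)·e X^(v+w)` satisfy
`T₁(s₁) < 0 < T₁(s₂)` for `T₁ = (u+v+w)·a − (v+w)·b X^u + w·c X^(u+v)`, i.e. `h₁ < s₁ < h₂ < s₂`).  This file turns the
interlacing into CHECKABLE ROWS: the negation of the interlacing is witnessed by signs of the two trinomials `T₁, T₂`
at TWO POINTS `r' , r` (in practice rationals, checked by `norm_num`), so that a certificate «this window 4-nomial has
at most two positive roots — hence the 21-nomial is not Descartes-sharp» needs no root isolation:

* `fourNomial_card_posRoots_le_two_of_right_witness` — `0 < r' < r`, `T₂(r') < 0 < T₂(r)`, `T₁(r) < 0` ⇒ `#Z₊(g) ≤ 2`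
  (the witness pins `s₁ < r' < r`, forces `s₂ < r ≤ h₂`, contradicting `h₂ < s₂`);
* `fourNomial_card_posRoots_le_two_of_left_witness` — `0 < r < r'`, `T₁(r') < 0 < T₁(r)`, `T₂(r) < 0` ⇒ `#Z₊(g) ≤ 2`
  (the witness pins `r ≤ h₁` and `s₁ < r`, contradicting `h₁ < s₁`).

Each hypothesis is the sign of ONE trinomial value, and every trinomial value is MONOTONE (affine) in each of the four
coefficients `a, b, c, e` separately; so on a box of coefficients one witness pair certifies a whole leaf by checking the
signs at the appropriate corners — this is how the W4 band `F₁(σ_BCD) < σ_ACD < F₂(σ_BCD)` (val-sym-door-p2 g7,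
THINK-g7.md §7; numerically: the val-sym-door-p1 g9 «W4 tube») becomes a finite list of log-linear rows with rational
witnesses for the cell's exact LP/domination certificates.  The witnesses themselves are data of a certificate; nothing in
this file chooses them.  Nothing here bounds any census count; `DoorA26` OPEN; nothing on `MatrixDescartes`
(stmt-ValiantsHypothesis-18050) or `VP ≠ VNP`.

[folklore] Intermediate value theorem + Descartes' bound for trinomials, on top of the interlacing lemma; elementary.
-/

-- `Summit.ValiantsHypothesis.ValiantsHypothesis.…` repeats a component by the D-0017 layout
-- (single-conjunct summit), which the `dupNamespace` linter flags; the name is mandated.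
set_option linter.dupNamespace false

namespace Summit.ValiantsHypothesis.ValiantsHypothesis.Theorems.LacunarySymmetroidMatrixDescartes.Census

open Polynomial Finset Set
open scoped BigOperators Polynomial

/-- A trinomial `x + y t^m + z t^n` (`x ≠ 0`, `0 < m`, `0 < n`) cannot vanish at three distinct positive points
(Descartes: at most two positive roots). [folklore] -/
theorem trinomial_three_posRoots_false {m n : ℕ} (hm : 0 < m) (hn : 0 < n) {x y z : ℝ} (hx : x ≠ 0)
    {ρ₁ ρ₂ ρ₃ : ℝ} (h₁ : 0 < ρ₁) (h₁₂ : ρ₁ < ρ₂) (h₂₃ : ρ₂ < ρ₃)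
    (e₁ : x + y * ρ₁ ^ m + z * ρ₁ ^ n = 0) (e₂ : x + y * ρ₂ ^ m + z * ρ₂ ^ n = 0)
    (e₃ : x + y * ρ₃ ^ m + z * ρ₃ ^ n = 0) : False := by
  set P : ℝ[X] := C x * X ^ 0 + C y * X ^ m + C z * X ^ n with hP
  have hev : ∀ t : ℝ, P.eval t = x + y * t ^ m + z * t ^ n := by
    intro t; simp [hP]
  have hP0 : P ≠ 0 := by
    intro h
    have h0 := hev 0
    rw [h, eval_zero, zero_pow hm.ne', zero_pow hn.ne', mul_zero, mul_zero, add_zero, add_zero] at h0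
    exact hx h0.symm
  have hle := card_posRoots_trinomial_le_two 0 m n x y z hP0
  rw [← hP] at hle
  have hmem : ∀ ρ : ℝ, 0 < ρ → x + y * ρ ^ m + z * ρ ^ n = 0 →
      ρ ∈ P.roots.toFinset.filter (fun t => 0 < t) := by
    intro ρ hρ he
    refine Finset.mem_filter.mpr ⟨?_, hρ⟩
    rw [Multiset.mem_toFinset, mem_roots hP0, IsRoot.def, hev]
    exact he
  have hsub : ({ρ₁, ρ₂, ρ₃} : Finset ℝ) ⊆ P.roots.toFinset.filter (fun t => 0 < t) := by
    intro ρ hρ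
    simp only [Finset.mem_insert, Finset.mem_singleton] at hρ
    rcases hρ with rfl | rfl | rfl
    · exact hmem _ h₁ e₁
    · exact hmem _ (h₁.trans h₁₂) e₂
    · exact hmem _ ((h₁.trans h₁₂).trans h₂₃) e₃
  have hcard : ({ρ₁, ρ₂, ρ₃} : Finset ℝ).card = 3 := by
    have h13 : ρ₁ ≠ ρ₃ := (h₁₂.trans h₂₃).ne
    rw [Finset.card_insert_of_notMem, Finset.card_insert_of_notMem, Finset.card_singleton]
    · simp [h₂₃.ne]
    · simp [h₁₂.ne, h13]
  have := Finset.card_le_card hsub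
  omega

/-- IVT helper: a continuous real function that is negative at `p` and positive at `q > p` vanishes strictly between.
[folklore] -/
theorem exists_zero_Ioo_of_neg_of_pos {f : ℝ → ℝ} (hf : Continuous f) {p q : ℝ} (hpq : p < q)
    (hp : f p < 0) (hq : 0 < f q) : ∃ ρ, p < ρ ∧ ρ < q ∧ f ρ = 0 := by
  have h := intermediate_value_Ioo hpq.le hf.continuousOn
  have h0 : (0 : ℝ) ∈ Ioo (f p) (f q) := ⟨hp, hq⟩
  obtain ⟨ρ, hρ, hfρ⟩ := h h0
  exact ⟨ρ, hρ.1, hρ.2, hfρ⟩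

/-- IVT helper: a continuous real function that is positive at `p` and negative at `q > p` vanishes strictly between.
[folklore] -/
theorem exists_zero_Ioo_of_pos_of_neg {f : ℝ → ℝ} (hf : Continuous f) {p q : ℝ} (hpq : p < q)
    (hp : 0 < f p) (hq : f q < 0) : ∃ ρ, p < ρ ∧ ρ < q ∧ f ρ = 0 := by
  have h := intermediate_value_Ioo' hpq.le hf.continuousOn
  have h0 : (0 : ℝ) ∈ Ioo (f q) (f p) := ⟨hq, hp⟩
  obtain ⟨ρ, hρ, hfρ⟩ := h h0
  exact ⟨ρ, hρ.1, hρ.2, hfρ⟩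

/-- **WINDOW-4 RIGHT WITNESS ROW.**  For `g = a − b X^u + c X^(u+v) − e X^(u+v+w)` (`a, b > 0`, `u, v, w ≥ 1`),
`T₂(x) = u·b − (u+v)·c x^v + (u+v+w)·e x^(v+w)` and `T₁(x) = (u+v+w)·a − (v+w)·b x^u + w·c x^(u+v)`:
if some `0 < r' < r` has `T₂(r') < 0 < T₂(r)` and `T₁(r) < 0`, then `g` has at most two distinct positive roots.
(With three roots, `r'` lies between the roots `s₁ < s₂` of `T₂`, so `s₂ < r`; then `T₁` changes sign on `(0,s₁)`,
`(s₁,s₂)` and `(s₂,r)` — three positive roots of a trinomial.) [folklore] -/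
theorem fourNomial_card_posRoots_le_two_of_right_witness {u v w : ℕ} (hu : 0 < u) (hv : 0 < v) (hw : 0 < w)
    {a b c e : ℝ} (ha : 0 < a) (hb : 0 < b) {r' r : ℝ} (hr' : 0 < r') (hrr : r' < r)
    (hT₂r' : (u : ℝ) * b - ((u : ℝ) + v) * c * r' ^ v + ((u : ℝ) + v + w) * e * r' ^ (v + w) < 0)
    (hT₂r : 0 < (u : ℝ) * b - ((u : ℝ) + v) * c * r ^ v + ((u : ℝ) + v + w) * e * r ^ (v + w))
    (hT₁r : ((u : ℝ) + v + w) * a - ((v : ℝ) + w) * b * r ^ u + (w : ℝ) * c * r ^ (u + v) < 0) :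
    ((C a - C b * X ^ u + C c * X ^ (u + v) - C e * X ^ (u + v + w)).roots.toFinset.filter
      (fun x => 0 < x)).card ≤ 2 := by
  by_contra hnot
  have h3 : 3 ≤ ((C a - C b * X ^ u + C c * X ^ (u + v) - C e * X ^ (u + v + w)).roots.toFinset.filter
      (fun x => 0 < x)).card := by omega
  obtain ⟨s₁, s₂, hs₁, hs₁₂, hT₂s₁, hT₂s₂, hT₁s₁, hT₁s₂⟩ :=
    fourNomial_interlacing_of_three_posRoots hu hv hw ha hb h3
  set T₂ : ℝ → ℝ := fun x => (u : ℝ) * b - ((u : ℝ) + v) * c * x ^ v + ((u : ℝ) + v + w) * e * x ^ (v + w)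
    with hT₂def
  set T₁ : ℝ → ℝ := fun x => ((u : ℝ) + v + w) * a - ((v : ℝ) + w) * b * x ^ u + (w : ℝ) * c * x ^ (u + v)
    with hT₁def
  have cT₂ : Continuous T₂ := by rw [hT₂def]; fun_prop
  have cT₁ : Continuous T₁ := by rw [hT₁def]; fun_prop
  have hvw : 0 < v + w := Nat.add_pos_left hv w
  have huv : 0 < u + v := Nat.add_pos_left hu v
  -- Descartes for the two trinomials, in the shape of `trinomial_three_posRoots_false`
  have noT₂ : ∀ ρ₁ ρ₂ ρ₃ : ℝ, 0 < ρ₁ → ρ₁ < ρ₂ → ρ₂ < ρ₃ → T₂ ρ₁ = 0 → T₂ ρ₂ = 0 → T₂ ρ₃ = 0 → False := by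
    intro ρ₁ ρ₂ ρ₃ h1 h12 h23 e1 e2 e3
    have hx : (u : ℝ) * b ≠ 0 := by positivity
    refine trinomial_three_posRoots_false (x := (u : ℝ) * b) (y := -(((u : ℝ) + v) * c))
      (z := ((u : ℝ) + v + w) * e) hv hvw hx h1 h12 h23 ?_ ?_ ?_
    · simp only [hT₂def] at e1; linarith
    · simp only [hT₂def] at e2; linarith
    · simp only [hT₂def] at e3; linarith
  have noT₁ : ∀ ρ₁ ρ₂ ρ₃ : ℝ, 0 < ρ₁ → ρ₁ < ρ₂ → ρ₂ < ρ₃ → T₁ ρ₁ = 0 → T₁ ρ₂ = 0 → T₁ ρ₃ = 0 → False := by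
    intro ρ₁ ρ₂ ρ₃ h1 h12 h23 e1 e2 e3
    have hx : ((u : ℝ) + v + w) * a ≠ 0 := by positivity
    refine trinomial_three_posRoots_false (x := ((u : ℝ) + v + w) * a) (y := -(((v : ℝ) + w) * b))
      (z := (w : ℝ) * c) hu huv hx h1 h12 h23 ?_ ?_ ?_
    · simp only [hT₁def] at e1; linarith
    · simp only [hT₁def] at e2; linarith
    · simp only [hT₁def] at e3; linarith
  have hT₂0 : 0 < T₂ 0 := by
    simp only [hT₂def, zero_pow hv.ne', zero_pow hvw.ne', mul_zero, add_zero, sub_zero]; positivity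
  have hT₁0 : 0 < T₁ 0 := by
    simp only [hT₁def, zero_pow hu.ne', zero_pow huv.ne', mul_zero, add_zero, sub_zero]; positivity
  have eT₂s₁ : T₂ s₁ = 0 := hT₂s₁
  have eT₂s₂ : T₂ s₂ = 0 := hT₂s₂
  have nT₂r' : T₂ r' < 0 := hT₂r'
  have pT₂r : 0 < T₂ r := hT₂r
  have nT₁r : T₁ r < 0 := hT₁r
  have nT₁s₁ : T₁ s₁ < 0 := hT₁s₁
  have pT₁s₂ : 0 < T₁ s₂ := hT₁s₂
  -- step 1: s₁ < r' < s₂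
  have hs₁r' : s₁ < r' := by
    rcases lt_trichotomy r' s₁ with hlt | heq | hgt
    · -- r' < s₁: a root of T₂ in (0, r'), distinct from s₁, s₂
      obtain ⟨ρ, hρ0, hρr, hρ⟩ := exists_zero_Ioo_of_pos_of_neg cT₂ hr' hT₂0 nT₂r'
      exact (noT₂ ρ s₁ s₂ hρ0 (hρr.trans hlt) hs₁₂ hρ eT₂s₁ eT₂s₂).elim
    · rw [heq] at nT₂r'; exact absurd eT₂s₁ nT₂r'.ne
    · exact hgt
  have hr's₂ : r' < s₂ := by
    rcases lt_trichotomy s₂ r' with hlt | heq | hgt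
    · -- s₂ < r': T₂(r') < 0 < T₂(r) gives a root beyond s₂
      obtain ⟨ρ, hρ1, hρ2, hρ⟩ := exists_zero_Ioo_of_neg_of_pos cT₂ hrr nT₂r' pT₂r
      exact (noT₂ s₁ s₂ ρ hs₁ hs₁₂ (hlt.trans hρ1) eT₂s₁ eT₂s₂ hρ).elim
    · rw [heq] at eT₂s₂; exact absurd eT₂s₂ nT₂r'.ne
    · exact hgt
  -- step 2: s₂ < r
  have hs₂r : s₂ < r := by
    rcases lt_trichotomy r s₂ with hlt | heq | hgt
    · -- r < s₂ : a root of T₂ in (r', r) ⊂ (s₁, s₂)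
      obtain ⟨ρ, hρ1, hρ2, hρ⟩ := exists_zero_Ioo_of_neg_of_pos cT₂ hrr nT₂r' pT₂r
      exact (noT₂ s₁ ρ s₂ hs₁ (hs₁r'.trans hρ1) (hρ2.trans hlt) eT₂s₁ hρ eT₂s₂).elim
    · rw [heq] at pT₂r; exact absurd eT₂s₂ pT₂r.ne'
    · exact hgt
  -- step 3: three positive roots of T₁
  obtain ⟨ρ₁, hρ₁0, hρ₁1, eρ₁⟩ := exists_zero_Ioo_of_pos_of_neg cT₁ hs₁ hT₁0 nT₁s₁
  obtain ⟨ρ₂, hρ₂0, hρ₂1, eρ₂⟩ := exists_zero_Ioo_of_neg_of_pos cT₁ hs₁₂ nT₁s₁ pT₁s₂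
  obtain ⟨ρ₃, hρ₃0, hρ₃1, eρ₃⟩ := exists_zero_Ioo_of_pos_of_neg cT₁ hs₂r pT₁s₂ nT₁r
  exact noT₁ ρ₁ ρ₂ ρ₃ hρ₁0 (hρ₁1.trans hρ₂0) (hρ₂1.trans hρ₃0) eρ₁ eρ₂ eρ₃

/-- **WINDOW-4 LEFT WITNESS ROW.**  Same `g, T₁, T₂`: if some `0 < r < r'` has `T₁(r') < 0 < T₁(r)` and
`T₂(r) < 0`, then `g` has at most two distinct positive roots.  (With three roots, `r` lies between the roots of `T₂`,
so `s₁ < r`; then `T₁` changes sign on `(0,s₁)`, `(s₁,r)` and `(r,r')`.) [folklore] -/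
theorem fourNomial_card_posRoots_le_two_of_left_witness {u v w : ℕ} (hu : 0 < u) (hv : 0 < v) (hw : 0 < w)
    {a b c e : ℝ} (ha : 0 < a) (hb : 0 < b) {r r' : ℝ} (hr : 0 < r) (hrr : r < r')
    (hT₁r' : ((u : ℝ) + v + w) * a - ((v : ℝ) + w) * b * r' ^ u + (w : ℝ) * c * r' ^ (u + v) < 0)
    (hT₁r : 0 < ((u : ℝ) + v + w) * a - ((v : ℝ) + w) * b * r ^ u + (w : ℝ) * c * r ^ (u + v))
    (hT₂r : (u : ℝ) * b - ((u : ℝ) + v) * c * r ^ v + ((u : ℝ) + v + w) * e * r ^ (v + w) < 0) :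
    ((C a - C b * X ^ u + C c * X ^ (u + v) - C e * X ^ (u + v + w)).roots.toFinset.filter
      (fun x => 0 < x)).card ≤ 2 := by
  by_contra hnot
  have h3 : 3 ≤ ((C a - C b * X ^ u + C c * X ^ (u + v) - C e * X ^ (u + v + w)).roots.toFinset.filter
      (fun x => 0 < x)).card := by omega
  obtain ⟨s₁, s₂, hs₁, hs₁₂, hT₂s₁, hT₂s₂, hT₁s₁, hT₁s₂⟩ :=
    fourNomial_interlacing_of_three_posRoots hu hv hw ha hb h3
  set T₂ : ℝ → ℝ := fun x => (u : ℝ) * b - ((u : ℝ) + v) * c * x ^ v + ((u : ℝ) + v + w) * e * x ^ (v + w)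
    with hT₂def
  set T₁ : ℝ → ℝ := fun x => ((u : ℝ) + v + w) * a - ((v : ℝ) + w) * b * x ^ u + (w : ℝ) * c * x ^ (u + v)
    with hT₁def
  have cT₂ : Continuous T₂ := by rw [hT₂def]; fun_prop
  have cT₁ : Continuous T₁ := by rw [hT₁def]; fun_prop
  have hvw : 0 < v + w := Nat.add_pos_left hv w
  have huv : 0 < u + v := Nat.add_pos_left hu v
  have noT₂ : ∀ ρ₁ ρ₂ ρ₃ : ℝ, 0 < ρ₁ → ρ₁ < ρ₂ → ρ₂ < ρ₃ → T₂ ρ₁ = 0 → T₂ ρ₂ = 0 → T₂ ρ₃ = 0 → False := by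
    intro ρ₁ ρ₂ ρ₃ h1 h12 h23 e1 e2 e3
    have hx : (u : ℝ) * b ≠ 0 := by positivity
    refine trinomial_three_posRoots_false (x := (u : ℝ) * b) (y := -(((u : ℝ) + v) * c))
      (z := ((u : ℝ) + v + w) * e) hv hvw hx h1 h12 h23 ?_ ?_ ?_
    · simp only [hT₂def] at e1; linarith
    · simp only [hT₂def] at e2; linarith
    · simp only [hT₂def] at e3; linarith
  have noT₁ : ∀ ρ₁ ρ₂ ρ₃ : ℝ, 0 < ρ₁ → ρ₁ < ρ₂ → ρ₂ < ρ₃ → T₁ ρ₁ = 0 → T₁ ρ₂ = 0 → T₁ ρ₃ = 0 → False := by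
    intro ρ₁ ρ₂ ρ₃ h1 h12 h23 e1 e2 e3
    have hx : ((u : ℝ) + v + w) * a ≠ 0 := by positivity
    refine trinomial_three_posRoots_false (x := ((u : ℝ) + v + w) * a) (y := -(((v : ℝ) + w) * b))
      (z := (w : ℝ) * c) hu huv hx h1 h12 h23 ?_ ?_ ?_
    · simp only [hT₁def] at e1; linarith
    · simp only [hT₁def] at e2; linarith
    · simp only [hT₁def] at e3; linarith
  have hT₂0 : 0 < T₂ 0 := by
    simp only [hT₂def, zero_pow hv.ne', zero_pow hvw.ne', mul_zero, add_zero, sub_zero]; positivity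
  have hT₁0 : 0 < T₁ 0 := by
    simp only [hT₁def, zero_pow hu.ne', zero_pow huv.ne', mul_zero, add_zero, sub_zero]; positivity
  have eT₂s₁ : T₂ s₁ = 0 := hT₂s₁
  have eT₂s₂ : T₂ s₂ = 0 := hT₂s₂
  have nT₂r : T₂ r < 0 := hT₂r
  have pT₁r : 0 < T₁ r := hT₁r
  have nT₁r' : T₁ r' < 0 := hT₁r'
  have nT₁s₁ : T₁ s₁ < 0 := hT₁s₁
  -- step 1: s₁ < r (r lies strictly between the two roots of T₂)
  have hs₁r : s₁ < r := by
    rcases lt_trichotomy r s₁ with hlt | heq | hgt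
    · obtain ⟨ρ, hρ0, hρr, hρ⟩ := exists_zero_Ioo_of_pos_of_neg cT₂ hr hT₂0 nT₂r
      exact (noT₂ ρ s₁ s₂ hρ0 (hρr.trans hlt) hs₁₂ hρ eT₂s₁ eT₂s₂).elim
    · rw [heq] at nT₂r; exact absurd eT₂s₁ nT₂r.ne
    · exact hgt
  -- step 2: three positive roots of T₁ in (0,s₁), (s₁,r), (r,r')
  obtain ⟨ρ₁, hρ₁0, hρ₁1, eρ₁⟩ := exists_zero_Ioo_of_pos_of_neg cT₁ hs₁ hT₁0 nT₁s₁
  obtain ⟨ρ₂, hρ₂0, hρ₂1, eρ₂⟩ := exists_zero_Ioo_of_neg_of_pos cT₁ hs₁r nT₁s₁ pT₁r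
  obtain ⟨ρ₃, hρ₃0, hρ₃1, eρ₃⟩ := exists_zero_Ioo_of_pos_of_neg cT₁ hrr pT₁r nT₁r'
  exact noT₁ ρ₁ ρ₂ ρ₃ hρ₁0 (hρ₁1.trans hρ₂0) (hρ₂1.trans hρ₃0) eρ₁ eρ₂ eρ₃

/-- **WINDOW-4 RIGHT WITNESS ROW, kill-`b` form.**  Same `g`, `T₂`; with the kill-`b` twist
`Φ(x) = u·a − v·c x^(u+v) + (v+w)·e x^(u+v+w)` (door-p2 g7's FACT 1; `fourNomial_interlacing_of_three_posRoots'`) in place of `T₁`: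
if some `0 < r' < r` has `T₂(r') < 0 < T₂(r)` and `Φ(r) < 0`, then `g` has at most two distinct positive roots.  In the gauge `c = e = 1`
the trinomial `T₂` depends on `b` alone and `Φ` on `a` alone, both affinely — the form in which a box of coefficients is certified at two
corners. [folklore] -/
theorem fourNomial_card_posRoots_le_two_of_right_witness' {u v w : ℕ} (hu : 0 < u) (hv : 0 < v) (hw : 0 < w)
    {a b c e : ℝ} (ha : 0 < a) (hb : 0 < b) {r' r : ℝ} (hr' : 0 < r') (hrr : r' < r)
    (hT₂r' : (u : ℝ) * b - ((u : ℝ) + v) * c * r' ^ v + ((u : ℝ) + v + w) * e * r' ^ (v + w) < 0)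
    (hT₂r : 0 < (u : ℝ) * b - ((u : ℝ) + v) * c * r ^ v + ((u : ℝ) + v + w) * e * r ^ (v + w))
    (hΦr : (u : ℝ) * a - (v : ℝ) * c * r ^ (u + v) + ((v : ℝ) + w) * e * r ^ (u + v + w) < 0) :
    ((C a - C b * X ^ u + C c * X ^ (u + v) - C e * X ^ (u + v + w)).roots.toFinset.filter
      (fun x => 0 < x)).card ≤ 2 := by
  by_contra hnot
  have h3 : 3 ≤ ((C a - C b * X ^ u + C c * X ^ (u + v) - C e * X ^ (u + v + w)).roots.toFinset.filter
      (fun x => 0 < x)).card := by omega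
  obtain ⟨s₁, s₂, hs₁, hs₁₂, hT₂s₁, hT₂s₂, hΦs₁, hΦs₂⟩ :=
    fourNomial_interlacing_of_three_posRoots' hu hv hw ha hb h3
  set T₂ : ℝ → ℝ := fun x => (u : ℝ) * b - ((u : ℝ) + v) * c * x ^ v + ((u : ℝ) + v + w) * e * x ^ (v + w)
    with hT₂def
  set Φ : ℝ → ℝ := fun x => (u : ℝ) * a - (v : ℝ) * c * x ^ (u + v) + ((v : ℝ) + w) * e * x ^ (u + v + w)
    with hΦdef
  have cT₂ : Continuous T₂ := by rw [hT₂def]; fun_prop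
  have cΦ : Continuous Φ := by rw [hΦdef]; fun_prop
  have hvw : 0 < v + w := Nat.add_pos_left hv w
  have huv : 0 < u + v := Nat.add_pos_left hu v
  have huvw : 0 < u + v + w := Nat.add_pos_left huv w
  have noT₂ : ∀ ρ₁ ρ₂ ρ₃ : ℝ, 0 < ρ₁ → ρ₁ < ρ₂ → ρ₂ < ρ₃ → T₂ ρ₁ = 0 → T₂ ρ₂ = 0 → T₂ ρ₃ = 0 → False := by
    intro ρ₁ ρ₂ ρ₃ h1 h12 h23 e1 e2 e3
    have hx : (u : ℝ) * b ≠ 0 := by positivity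
    refine trinomial_three_posRoots_false (x := (u : ℝ) * b) (y := -(((u : ℝ) + v) * c))
      (z := ((u : ℝ) + v + w) * e) hv hvw hx h1 h12 h23 ?_ ?_ ?_
    · simp only [hT₂def] at e1; linarith
    · simp only [hT₂def] at e2; linarith
    · simp only [hT₂def] at e3; linarith
  have noΦ : ∀ ρ₁ ρ₂ ρ₃ : ℝ, 0 < ρ₁ → ρ₁ < ρ₂ → ρ₂ < ρ₃ → Φ ρ₁ = 0 → Φ ρ₂ = 0 → Φ ρ₃ = 0 → False := by
    intro ρ₁ ρ₂ ρ₃ h1 h12 h23 e1 e2 e3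
    have hx : (u : ℝ) * a ≠ 0 := by positivity
    refine trinomial_three_posRoots_false (x := (u : ℝ) * a) (y := -((v : ℝ) * c))
      (z := ((v : ℝ) + w) * e) huv huvw hx h1 h12 h23 ?_ ?_ ?_
    · simp only [hΦdef] at e1; linarith
    · simp only [hΦdef] at e2; linarith
    · simp only [hΦdef] at e3; linarith
  have hT₂0 : 0 < T₂ 0 := by
    simp only [hT₂def, zero_pow hv.ne', zero_pow hvw.ne', mul_zero, add_zero, sub_zero]; positivity
  have hΦ0 : 0 < Φ 0 := by
    simp only [hΦdef, zero_pow huv.ne', zero_pow huvw.ne', mul_zero, add_zero, sub_zero]; positivity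
  have eT₂s₁ : T₂ s₁ = 0 := hT₂s₁
  have eT₂s₂ : T₂ s₂ = 0 := hT₂s₂
  have nT₂r' : T₂ r' < 0 := hT₂r'
  have pT₂r : 0 < T₂ r := hT₂r
  have nΦr : Φ r < 0 := hΦr
  have nΦs₁ : Φ s₁ < 0 := hΦs₁
  have pΦs₂ : 0 < Φ s₂ := hΦs₂
  have hs₁r' : s₁ < r' := by
    rcases lt_trichotomy r' s₁ with hlt | heq | hgt
    · obtain ⟨ρ, hρ0, hρr, hρ⟩ := exists_zero_Ioo_of_pos_of_neg cT₂ hr' hT₂0 nT₂r'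
      exact (noT₂ ρ s₁ s₂ hρ0 (hρr.trans hlt) hs₁₂ hρ eT₂s₁ eT₂s₂).elim
    · rw [heq] at nT₂r'; exact absurd eT₂s₁ nT₂r'.ne
    · exact hgt
  have hs₂r : s₂ < r := by
    rcases lt_trichotomy r s₂ with hlt | heq | hgt
    · obtain ⟨ρ, hρ1, hρ2, hρ⟩ := exists_zero_Ioo_of_neg_of_pos cT₂ hrr nT₂r' pT₂r
      exact (noT₂ s₁ ρ s₂ hs₁ (hs₁r'.trans hρ1) (hρ2.trans hlt) eT₂s₁ hρ eT₂s₂).elim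
    · rw [heq] at pT₂r; exact absurd eT₂s₂ pT₂r.ne'
    · exact hgt
  obtain ⟨ρ₁, hρ₁0, hρ₁1, eρ₁⟩ := exists_zero_Ioo_of_pos_of_neg cΦ hs₁ hΦ0 nΦs₁
  obtain ⟨ρ₂, hρ₂0, hρ₂1, eρ₂⟩ := exists_zero_Ioo_of_neg_of_pos cΦ hs₁₂ nΦs₁ pΦs₂
  obtain ⟨ρ₃, hρ₃0, hρ₃1, eρ₃⟩ := exists_zero_Ioo_of_pos_of_neg cΦ hs₂r pΦs₂ nΦr
  exact noΦ ρ₁ ρ₂ ρ₃ hρ₁0 (hρ₁1.trans hρ₂0) (hρ₂1.trans hρ₃0) eρ₁ eρ₂ eρ₃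

/-- **WINDOW-4 LEFT WITNESS ROW, kill-`b` form.**  If some `0 < r < r'` has `Φ(r') < 0 < Φ(r)` and `T₂(r) < 0`, then `g`
has at most two distinct positive roots. [folklore] -/
theorem fourNomial_card_posRoots_le_two_of_left_witness' {u v w : ℕ} (hu : 0 < u) (hv : 0 < v) (hw : 0 < w)
    {a b c e : ℝ} (ha : 0 < a) (hb : 0 < b) {r r' : ℝ} (hr : 0 < r) (hrr : r < r')
    (hΦr' : (u : ℝ) * a - (v : ℝ) * c * r' ^ (u + v) + ((v : ℝ) + w) * e * r' ^ (u + v + w) < 0)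
    (hΦr : 0 < (u : ℝ) * a - (v : ℝ) * c * r ^ (u + v) + ((v : ℝ) + w) * e * r ^ (u + v + w))
    (hT₂r : (u : ℝ) * b - ((u : ℝ) + v) * c * r ^ v + ((u : ℝ) + v + w) * e * r ^ (v + w) < 0) :
    ((C a - C b * X ^ u + C c * X ^ (u + v) - C e * X ^ (u + v + w)).roots.toFinset.filter
      (fun x => 0 < x)).card ≤ 2 := by
  by_contra hnot
  have h3 : 3 ≤ ((C a - C b * X ^ u + C c * X ^ (u + v) - C e * X ^ (u + v + w)).roots.toFinset.filter
      (fun x => 0 < x)).card := by omega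
  obtain ⟨s₁, s₂, hs₁, hs₁₂, hT₂s₁, hT₂s₂, hΦs₁, hΦs₂⟩ :=
    fourNomial_interlacing_of_three_posRoots' hu hv hw ha hb h3
  set T₂ : ℝ → ℝ := fun x => (u : ℝ) * b - ((u : ℝ) + v) * c * x ^ v + ((u : ℝ) + v + w) * e * x ^ (v + w)
    with hT₂def
  set Φ : ℝ → ℝ := fun x => (u : ℝ) * a - (v : ℝ) * c * x ^ (u + v) + ((v : ℝ) + w) * e * x ^ (u + v + w)
    with hΦdef
  have cT₂ : Continuous T₂ := by rw [hT₂def]; fun_prop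
  have cΦ : Continuous Φ := by rw [hΦdef]; fun_prop
  have hvw : 0 < v + w := Nat.add_pos_left hv w
  have huv : 0 < u + v := Nat.add_pos_left hu v
  have huvw : 0 < u + v + w := Nat.add_pos_left huv w
  have noT₂ : ∀ ρ₁ ρ₂ ρ₃ : ℝ, 0 < ρ₁ → ρ₁ < ρ₂ → ρ₂ < ρ₃ → T₂ ρ₁ = 0 → T₂ ρ₂ = 0 → T₂ ρ₃ = 0 → False := by
    intro ρ₁ ρ₂ ρ₃ h1 h12 h23 e1 e2 e3
    have hx : (u : ℝ) * b ≠ 0 := by positivity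
    refine trinomial_three_posRoots_false (x := (u : ℝ) * b) (y := -(((u : ℝ) + v) * c))
      (z := ((u : ℝ) + v + w) * e) hv hvw hx h1 h12 h23 ?_ ?_ ?_
    · simp only [hT₂def] at e1; linarith
    · simp only [hT₂def] at e2; linarith
    · simp only [hT₂def] at e3; linarith
  have noΦ : ∀ ρ₁ ρ₂ ρ₃ : ℝ, 0 < ρ₁ → ρ₁ < ρ₂ → ρ₂ < ρ₃ → Φ ρ₁ = 0 → Φ ρ₂ = 0 → Φ ρ₃ = 0 → False := by
    intro ρ₁ ρ₂ ρ₃ h1 h12 h23 e1 e2 e3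
    have hx : (u : ℝ) * a ≠ 0 := by positivity
    refine trinomial_three_posRoots_false (x := (u : ℝ) * a) (y := -((v : ℝ) * c))
      (z := ((v : ℝ) + w) * e) huv huvw hx h1 h12 h23 ?_ ?_ ?_
    · simp only [hΦdef] at e1; linarith
    · simp only [hΦdef] at e2; linarith
    · simp only [hΦdef] at e3; linarith
  have hT₂0 : 0 < T₂ 0 := by
    simp only [hT₂def, zero_pow hv.ne', zero_pow hvw.ne', mul_zero, add_zero, sub_zero]; positivity
  have hΦ0 : 0 < Φ 0 := by
    simp only [hΦdef, zero_pow huv.ne', zero_pow huvw.ne', mul_zero, add_zero, sub_zero]; positivity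
  have eT₂s₁ : T₂ s₁ = 0 := hT₂s₁
  have eT₂s₂ : T₂ s₂ = 0 := hT₂s₂
  have nT₂r : T₂ r < 0 := hT₂r
  have pΦr : 0 < Φ r := hΦr
  have nΦr' : Φ r' < 0 := hΦr'
  have nΦs₁ : Φ s₁ < 0 := hΦs₁
  have hs₁r : s₁ < r := by
    rcases lt_trichotomy r s₁ with hlt | heq | hgt
    · obtain ⟨ρ, hρ0, hρr, hρ⟩ := exists_zero_Ioo_of_pos_of_neg cT₂ hr hT₂0 nT₂r
      exact (noT₂ ρ s₁ s₂ hρ0 (hρr.trans hlt) hs₁₂ hρ eT₂s₁ eT₂s₂).elim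
    · rw [heq] at nT₂r; exact absurd eT₂s₁ nT₂r.ne
    · exact hgt
  obtain ⟨ρ₁, hρ₁0, hρ₁1, eρ₁⟩ := exists_zero_Ioo_of_pos_of_neg cΦ hs₁ hΦ0 nΦs₁
  obtain ⟨ρ₂, hρ₂0, hρ₂1, eρ₂⟩ := exists_zero_Ioo_of_neg_of_pos cΦ hs₁r nΦs₁ pΦr
  obtain ⟨ρ₃, hρ₃0, hρ₃1, eρ₃⟩ := exists_zero_Ioo_of_pos_of_neg cΦ hrr pΦr nΦr'
  exact noΦ ρ₁ ρ₂ ρ₃ hρ₁0 (hρ₁1.trans hρ₂0) (hρ₂1.trans hρ₃0) eρ₁ eρ₂ eρ₃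

end Summit.ValiantsHypothesis.ValiantsHypothesis.Theorems.LacunarySymmetroidMatrixDescartes.Census
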